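import Literature.LinearAlgebra.Matrix.MatrixScalingPattern
import HarnessLib

/-!
# Cut conditions for scalability: Menon's inequalities `Σ_I r_i ≥ Σ_J c_j` whenever `A_{Iᶜ J} = 0` (Idel Theorem 4.1)
# and Brualdi's partition inequalities for symmetric scaling (Idel Theorem 5.4 (3)) — the necessity halves

Layer `Literature/LinearAlgebra/Matrix`, namespace `Literature.LinearAlgebra.Matrix.ScalingCutConditions`.
Written for lane `lit-hodgefound` (prover seat `lit-hodgefound-p31`, gen 41, row g41-#13); sequel of
✔ `MatrixScalingPattern.lean` (Theorem 3.1) and ✔ `SymmetricMatrixScaling.lean` (Theorem 5.4 (1) ⇔ (2)). Everything is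
PROVED; no definition, no named fact. ONLY THE NECESSITY of the cut conditions (with their equality clauses) is
formalised; their sufficiency (Menon 1969 ∕ Brualdi 1968: a flow-feasibility theorem) is not.

## Source (held text, verbatim)

M. Idel, *A review of matrix scaling …*, arXiv:1609.06349 [cite: Idel2016] (held text `paper:arxiv-1609.06349`):
* §4 Theorem 4.1, p0013: «Let `A ∈ ℝ^{n×m}` be a nonnegative matrix and `r ∈ ℝ^n_+, c ∈ ℝ^m_+`. Then the following are
  equivalent: • There exist positive diagonal matrices `D₁, D₂` such that `D₁AD₂` has row sums `r` and column sums
  `c`. • There exists a matrix `B` with row sums `r` and column sums `c` with the same pattern as `A`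
  ([men68, bru68]). • … • For every `I ⊂ {1,…,m}, J ⊂ {1,…,n}` such that `A_{IᶜJ} = 0` we have that
  `Σ_{i∈I} r_i ≥ Σ_{j∈J} c_j` and equality holds if and only if `A_{IJᶜ} = 0` ([men69]).»
* §5 Theorem 5.4 ([bru74]), p0015–p0016: «Let `A ∈ ℝ^{n×n}` be a symmetric nonnegative matrix. Then the following are
  equivalent: • There exists a diagonal matrix `D` with positive entries such that `DAD` has row sums given by
  `r ∈ ℝ^n_+`. • There exists a symmetric nonnegative matrix `B` with the same pattern as `A` and row sums `r`. • For
  all partitions `{I,J,K}` of `{1,…,n}` such that `A(J∪K,K) = 0`, `Σ_{i∈I} r_i ≥ Σ_{i∈K} r_i` with equality if and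
  only if `A(I,I∪J) = 0`. … The equivalence of 2. and 3. is given in [bru68].»

## What is proved

* §1 `sum_col_le_sum_row_of_zero_block`, `sum_col_eq_sum_row_iff`: for `B ≥ 0` with the pattern of `A` and margins
  `(r, c)` and `A_{IᶜJ} = 0`, `Σ_J c ≤ Σ_I r` (the `J`-columns of `B` live on the `I`-rows), with equality iff
  `A_{IJᶜ} = 0` (the slack is `Σ_{I×Jᶜ} b`); `menon_condition_of_scaling`: the same for a scaling `D(y) A D(x)`
  ((i) ⇒ (iv) of Theorem 4.1); `sum_col_eq_sum_row`: `Σ c = Σ r`.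
* §2 `brualdi_condition_of_pattern`, `brualdi_condition_of_symmetric_scaling`: for symmetric `B ≥ 0` with the pattern
  of `A` and row sums `r` (resp. a symmetric scaling `(d_i a_ij d_j)`), and `A(Iᶜ, K) = 0`: `Σ_K r ≤ Σ_I r`, equality
  iff `A(I, Kᶜ) = 0` ((2) ⇒ (3), (1) ⇒ (3) of Theorem 5.4).

DECLARED deviations. (i) Only necessity (and the equality clauses) — NOT the sufficiency of the conditions. (ii) In
§2 the printed partition `{I, J, K}` enters only through `A(J ∪ K, K) = A(Iᶜ, K) = 0` and `I ∪ J = Kᶜ`; the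
disjointness of `I` and `K` is not needed for the necessity and is not assumed. (iii) `B` nonnegative (standing
convention of the survey).
-/

open Matrix Finset

namespace Literature.LinearAlgebra.Matrix.ScalingCutConditions

variable {m n : Type*} [Fintype m] [Fintype n]
variable {A B : Matrix m n ℝ} {r : m → ℝ} {c : n → ℝ}

/-! ### §1 Menon's condition (Idel Theorem 4.1, last item): necessity and the equality clause -/

/-- **Idel Theorem 4.1, (ii) ⇒ (iv) with the equality clause (Menon 1969).** Let `B ≥ 0` have the pattern of `A`,
row sums `r` and column sums `c`. Then for all `I ⊆ rows`, `J ⊆ columns` with `A_{Iᶜ J} = 0`: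
`Σ_{j ∈ J} c_j ≤ Σ_{i ∈ I} r_i` («For every `I ⊂ {1,…,m}, J ⊂ {1,…,n}` such that `A_{IᶜJ} = 0` we have that
`Σ_{i∈I} r_i ≥ Σ_{j∈J} c_j`»): the columns in `J` are supported on the rows in `I`.
[cite: Idel2016, §4 Theorem 4.1 (last item, necessity), p0013] -/
theorem sum_col_le_sum_row_of_zero_block (hB : ∀ i j, 0 ≤ B i j) (hpat : ∀ i j, A i j = 0 ↔ B i j = 0)
    (hBr : ∀ i, ∑ j, B i j = r i) (hBc : ∀ j, ∑ i, B i j = c j) {I : Finset m} {J : Finset n}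
    (hzero : ∀ i ∉ I, ∀ j ∈ J, A i j = 0) : ∑ j ∈ J, c j ≤ ∑ i ∈ I, r i := by
  calc ∑ j ∈ J, c j = ∑ j ∈ J, ∑ i, B i j := sum_congr rfl fun j _ ↦ (hBc j).symm
    _ = ∑ j ∈ J, ∑ i ∈ I, B i j := by
        refine sum_congr rfl fun j hj ↦ ?_
        rw [← sum_subset (subset_univ I) fun i _ hi ↦ (hpat i j).1 (hzero i hi j hj)]
    _ = ∑ i ∈ I, ∑ j ∈ J, B i j := sum_comm
    _ ≤ ∑ i ∈ I, ∑ j, B i j := sum_le_sum fun i _ ↦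
        sum_le_sum_of_subset_of_nonneg (subset_univ J) fun j _ _ ↦ hB i j
    _ = ∑ i ∈ I, r i := sum_congr rfl fun i _ ↦ hBr i

/-- **… and equality holds iff `A_{I Jᶜ} = 0`** («and equality holds if and only if `A_{IJᶜ} = 0`»): the slack is
`Σ_{i ∈ I, j ∉ J} b_ij`. [cite: Idel2016, §4 Theorem 4.1 (last item, equality clause), p0013] -/
theorem sum_col_eq_sum_row_iff [DecidableEq n] (hB : ∀ i j, 0 ≤ B i j) (hpat : ∀ i j, A i j = 0 ↔ B i j = 0)
    (hBr : ∀ i, ∑ j, B i j = r i) (hBc : ∀ j, ∑ i, B i j = c j) {I : Finset m} {J : Finset n}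
    (hzero : ∀ i ∉ I, ∀ j ∈ J, A i j = 0) :
    ∑ j ∈ J, c j = ∑ i ∈ I, r i ↔ ∀ i ∈ I, ∀ j ∉ J, A i j = 0 := by
  -- the slack identity `Σ_I r − Σ_J c = Σ_{I × Jᶜ} b`
  have h1 : ∑ j ∈ J, c j = ∑ i ∈ I, ∑ j ∈ J, B i j := by
    calc ∑ j ∈ J, c j = ∑ j ∈ J, ∑ i, B i j := sum_congr rfl fun j _ ↦ (hBc j).symm
      _ = ∑ j ∈ J, ∑ i ∈ I, B i j := by
          refine sum_congr rfl fun j hj ↦ ?_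
          rw [← sum_subset (subset_univ I) fun i _ hi ↦ (hpat i j).1 (hzero i hi j hj)]
      _ = ∑ i ∈ I, ∑ j ∈ J, B i j := sum_comm
  have h2 : ∑ i ∈ I, r i = ∑ i ∈ I, ∑ j ∈ J, B i j + ∑ i ∈ I, ∑ j ∈ Jᶜ, B i j := by
    rw [← sum_add_distrib]
    exact sum_congr rfl fun i _ ↦ by rw [← hBr i, sum_add_sum_compl]
  rw [h1, h2]
  constructor
  · intro h
    have h0 : ∑ i ∈ I, ∑ j ∈ Jᶜ, B i j = 0 := by linarith
    rw [sum_eq_zero_iff_of_nonneg fun i _ ↦ sum_nonneg fun j _ ↦ hB i j] at h0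
    intro i hi j hj
    have h3 := h0 i hi
    rw [sum_eq_zero_iff_of_nonneg fun j _ ↦ hB i j] at h3
    exact (hpat i j).2 (h3 j (mem_compl.2 hj))
  · intro h
    have h0 : ∑ i ∈ I, ∑ j ∈ Jᶜ, B i j = 0 :=
      sum_eq_zero fun i hi ↦ sum_eq_zero fun j hj ↦ (hpat i j).1 (h i hi j (mem_compl.1 hj))
    rw [h0, add_zero]

/-- **Idel Theorem 4.1, (i) ⇒ (iv): Menon's condition is necessary for scalability.** If positive diagonal `D(y)`,
`D(x)` scale `A ≥ 0` to row sums `r` and column sums `c`, then `Σ_{j∈J} c_j ≤ Σ_{i∈I} r_i` whenever `A_{IᶜJ} = 0`,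
with equality iff `A_{IJᶜ} = 0`. [cite: Idel2016, §4 Theorem 4.1 ((i) ⇒ last item), p0013] -/
theorem menon_condition_of_scaling [DecidableEq n] (hA : ∀ i j, 0 ≤ A i j) {x : n → ℝ} {y : m → ℝ} (hx : ∀ j, 0 < x j)
    (hy : ∀ i, 0 < y i) (hrow : ∀ i, ∑ j, y i * A i j * x j = r i) (hcol : ∀ j, ∑ i, y i * A i j * x j = c j)
    {I : Finset m} {J : Finset n} (hzero : ∀ i ∉ I, ∀ j ∈ J, A i j = 0) :
    ∑ j ∈ J, c j ≤ ∑ i ∈ I, r i ∧ (∑ j ∈ J, c j = ∑ i ∈ I, r i ↔ ∀ i ∈ I, ∀ j ∉ J, A i j = 0) := by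
  obtain ⟨hnn, hp⟩ := MatrixScalingPattern.pattern_of_scaling hA hx hy
  exact ⟨sum_col_le_sum_row_of_zero_block (B := of fun i j ↦ y i * A i j * x j) (fun i j ↦ hnn i j)
      (fun i j ↦ hp i j) hrow hcol hzero,
    sum_col_eq_sum_row_iff (B := of fun i j ↦ y i * A i j * x j) (fun i j ↦ hnn i j) (fun i j ↦ hp i j) hrow
      hcol hzero⟩

/-- The case `I = ∅ᶜ = univ`, `J = univ`: the total sums agree, `Σ c = Σ r`. [cite: Idel2016, §4 Theorem 4.1
(last item with `I = {1,…,m}`, `J = {1,…,n}`), p0013] -/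
theorem sum_col_eq_sum_row (hBr : ∀ i, ∑ j, B i j = r i) (hBc : ∀ j, ∑ i, B i j = c j) :
    ∑ j, c j = ∑ i, r i := by
  calc ∑ j, c j = ∑ j, ∑ i, B i j := sum_congr rfl fun j _ ↦ (hBc j).symm
    _ = ∑ i, ∑ j, B i j := sum_comm
    _ = ∑ i, r i := sum_congr rfl fun i _ ↦ hBr i

/-! ### §2 Brualdi's partition condition for symmetric scaling (Idel Theorem 5.4 (3)): necessity -/

/-- **Idel Theorem 5.4, (2) ⇒ (3) with the equality clause (Brualdi 1968).** Let `B ≥ 0` be symmetric with the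
pattern of the symmetric `A` and row sums `r`. For every partition `{I, J, K}` of the index set with `A(J ∪ K, K) = 0`
— here: any `I`, `K` with `A(Iᶜ, K) = 0` (disjointness is not needed), `I ∪ J` read as `Kᶜ` —
`Σ_{k∈K} r_k ≤ Σ_{i∈I} r_i`, with equality iff `A(I, Kᶜ) = 0` («For all partitions `{I,J,K}` of `{1,…,n}` such that `A(J∪K,K) = 0`, `Σ_{i∈I} r_i ≥ Σ_{i∈K}
r_i` with equality if and only if `A(I,I∪J) = 0`»): the rows in `K` are supported on the columns in `I`.
[cite: Idel2016, §5 Theorem 5.4 (item 3, necessity and equality clause), p0016] -/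
theorem brualdi_condition_of_pattern [DecidableEq n] {A B : Matrix n n ℝ} {r : n → ℝ} (hB : ∀ i j, 0 ≤ B i j)
    (hBs : ∀ i j, B i j = B j i) (hpat : ∀ i j, A i j = 0 ↔ B i j = 0) (hBr : ∀ i, ∑ j, B i j = r i)
    {I K : Finset n} (hzero : ∀ i ∉ I, ∀ k ∈ K, A i k = 0) :
    ∑ k ∈ K, r k ≤ ∑ i ∈ I, r i ∧ (∑ k ∈ K, r k = ∑ i ∈ I, r i ↔ ∀ i ∈ I, ∀ l ∉ K, A i l = 0) := by
  -- row `k ∈ K` of `B` is supported on `I` (by symmetry and `A((I)ᶜ, K) = 0`)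
  have hcolK : ∀ k ∈ K, ∑ l, B k l = ∑ i ∈ I, B k i := fun k hk ↦ by
    rw [← sum_subset (subset_univ I) fun i _ hi ↦ by rw [hBs]; exact (hpat i k).1 (hzero i hi k hk)]
  have h1 : ∑ k ∈ K, r k = ∑ i ∈ I, ∑ k ∈ K, B i k := by
    calc ∑ k ∈ K, r k = ∑ k ∈ K, ∑ i ∈ I, B k i := sum_congr rfl fun k hk ↦ by rw [← hBr k, hcolK k hk]
      _ = ∑ k ∈ K, ∑ i ∈ I, B i k := sum_congr rfl fun k _ ↦ sum_congr rfl fun i _ ↦ hBs k i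
      _ = ∑ i ∈ I, ∑ k ∈ K, B i k := sum_comm
  have h2 : ∑ i ∈ I, r i = ∑ i ∈ I, ∑ k ∈ K, B i k + ∑ i ∈ I, ∑ l ∈ Kᶜ, B i l := by
    rw [← sum_add_distrib]
    exact sum_congr rfl fun i _ ↦ by rw [← hBr i, sum_add_sum_compl]
  have hslack : 0 ≤ ∑ i ∈ I, ∑ l ∈ Kᶜ, B i l := sum_nonneg fun i _ ↦ sum_nonneg fun l _ ↦ hB i l
  refine ⟨by rw [h1, h2]; linarith, ?_⟩
  rw [h1, h2]
  constructor
  · intro h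
    have h0 : ∑ i ∈ I, ∑ l ∈ Kᶜ, B i l = 0 := by linarith
    rw [sum_eq_zero_iff_of_nonneg fun i _ ↦ sum_nonneg fun l _ ↦ hB i l] at h0
    intro i hi l hl
    have h3 := h0 i hi
    rw [sum_eq_zero_iff_of_nonneg fun l _ ↦ hB i l] at h3
    exact (hpat i l).2 (h3 l (mem_compl.2 hl))
  · intro h
    have h0 : ∑ i ∈ I, ∑ l ∈ Kᶜ, B i l = 0 :=
      sum_eq_zero fun i hi ↦ sum_eq_zero fun l hl ↦ (hpat i l).1 (h i hi l (mem_compl.1 hl))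
    rw [h0, add_zero]

/-- **Idel Theorem 5.4, (1) ⇒ (3): Brualdi's condition is necessary for a symmetric scaling.** If `(d_i a_ij d_j)`
(`d > 0`, `A ≥ 0` symmetric) has row sums `r`, then for `I`, `K` with `A(Iᶜ, K) = 0`:
`Σ_K r ≤ Σ_I r`, with equality iff `A(I, Kᶜ) = 0`. [cite: Idel2016, §5 Theorem 5.4 ((1) ⇒ item 3), p0016] -/
theorem brualdi_condition_of_symmetric_scaling [DecidableEq n] {A : Matrix n n ℝ} {r : n → ℝ}
    (hA : ∀ i j, 0 ≤ A i j) (hAs : ∀ i j, A i j = A j i) {d : n → ℝ} (hd : ∀ i, 0 < d i)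
    (hr : ∀ i, ∑ j, d i * A i j * d j = r i) {I K : Finset n} (hzero : ∀ i ∉ I, ∀ k ∈ K, A i k = 0) :
    ∑ k ∈ K, r k ≤ ∑ i ∈ I, r i ∧ (∑ k ∈ K, r k = ∑ i ∈ I, r i ↔ ∀ i ∈ I, ∀ l ∉ K, A i l = 0) := by
  obtain ⟨hnn, hp⟩ := MatrixScalingPattern.pattern_of_scaling hA hd hd
  exact brualdi_condition_of_pattern (B := of fun i j ↦ d i * A i j * d j) (fun i j ↦ hnn i j)
    (fun i j ↦ by simp only [of_apply]; rw [hAs i j]; ring) (fun i j ↦ hp i j) hr hzero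

end Literature.LinearAlgebra.Matrix.ScalingCutConditions
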